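/-
Copyright (c) 2026 the pub-hodgecm-mathlib formalisation cell (harness21).  Prover seat hodgecm-mathlib-R90-C10-p05 (g3), R90-TF SLAB section S1 «Ch10-local», (S-W) line lead,
card (c3) part 2 of ruling R-SW-4: U4Keys :182 WILD corner, cell (S-W-Rb), sub-cell (Rb-odd) «cond_E `n` odd, `n ≥ 2δ + 3`» — THE WILD DEPTH-WITNESS COVER of the
intermediate lower cells of the two-depth group at the (R-b) datum, assembled from ★ (c1) `R90S1WildFamilyXWitness` (R90-C10-p04 (g3)), ★ (c2) `R90S1WildFamilyZWitness`
(R90-C10-p03 (g2)) and ★ (c3) part 1 `R90S1WildDepthWitnessCoverArith` (this seat) — the wild twin of ★ `K2E3TwoDepthDepthWitnessCover.exists_depth_witness_twoDepth`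
(K2E3-p37 (g2)).  MODEL level, THEOREMS ONLY.  NOT THE PAYER of :182.
-/
import Summits.HodgeConjecture.HodgeConjecture.Theorems.R90S1WildFamilyXWitness          -- ★ (c1) (R90-C10-p04 (g3)): `exists_familyX_witness_twoDepth_ofDefect`
import Summits.HodgeConjecture.HodgeConjecture.Theorems.R90S1WildFamilyZWitness          -- ★ (c2) (R90-C10-p03 (g2)): `exists_familyZ_witness_twoDepth_ofDefect`
import Summits.HodgeConjecture.HodgeConjecture.Theorems.R90S1WildDepthWitnessCoverArith  -- ★ (c3) part 1 (this seat): `cover_arith_wild`, `cover_arith_wild_swap`, `cover_arith_wild_zero`; brings ★ `K2E3TwoDepthDepthWitnessCover` (`v_pow_eq_exp`)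
import HarnessLib

/-!
# R90-TF S1 «Ch10-local» — U4Keys :182, THE WILD CORNER (S-W), cell (S-W-Rb), sub-cell (Rb-odd): THE WILD DEPTH-WITNESS COVER
# «at a place with a MINIMAL trace-one element of defect `δ ≥ 1` (`|t| = |ϖ|^{−δ}`), for cond_E `n = m + 1` ODD, `n ≥ 2δ + 3`, every intermediate lower cell `ū(x,z)` of `J_{e_W}`,
# `e_W = (⌊n∕2⌋, δ; ⌈n∕2⌉, δ + 1)` or its `w`-swap, whose `z`-level obeys the wild NO-CANCELLATION law, carries a depth witness of family X (`c₁ ∈ 𝔭ᵐ`) or Z (`c₂ ∈ 𝔭^{2δ}` σ-fixed)»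
# [Roche1998 §3–§4; BruhatTits1972 (6.4.9); Tits1979 §1.15; Casselman1995 §6.3; Serre1979 III §3]

Cell hodgecm-mathlib, R90-TF SLAB, crux item H413 = `stmt-HodgeConjecture-24833` (route `HCCMUnconditional`, no route verbs); serves BY NAME the OPEN tier-0 socket (S-W)
`…U4Keys.sig_K2E3KeysThmTwoContractingRamifiedCharOnePosDepthWild` through its cell letter `HWRb` (★ (W-5) p865171) and the WILD DETERMINANT ROAD producing it — this is the road's
`hwit` ORGAN on the lower intermediate cells (the tame organ is ★ `exists_depth_witness_twoDepth`, consumed by ★ p862990 ∕ ★ (B-2b′) `shellWitness_family`).  Author R90-C10-p05 (g3).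
`--supports stmt-HodgeConjecture-24833 --as helper`; THEOREMS ONLY; MODEL level = ★ `K2E3TwoDepthDepthWitnessCover`'s `Valuation` frame VERBATIM (`σ hJ hσ hvσ hvϖ r s r' s' Jg hJg`).
NOT THE PAYER of :182; the CM dress (pull-back along `eA`, the datum's `t`, `δ := d − 1` via ★ bridge p865207, and the discharge of the no-cancellation letter from the wild
quadratic datum) is the next brick.

THE POINT.  ★ `exists_depth_witness_twoDepth` binds an INTEGRAL trace-one `t` (`hvt`).  With a minimal `t` of defect `δ` (★ (W-0) p865099) the two families survive with
shifted regimes — ★ (c1) (X: `hz2` by `δ`, `s + δ ≤ 2r`, `s' + δ ≤ 2r'`, `δ ≤ m`) and ★ (c2) (Z: `hε` by `δ`) — and the cell arithmetic ★ (c3) part 1 shows the shifted regimes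
still COVER every cell at the (R-b) datum `(⌊n∕2⌋, δ; ⌈n∕2⌉, δ+1)` (and its swap), `k = 2δ`, PROVIDED `n` is odd, `n ≥ 2δ + 3`, and the cell's `z`-level obeys the wild
no-cancellation law `|z| = |t|·|x|² ∨ log|z| ≡ δ + 1 (mod 2)` (`z = −t·N(x) + y'`, `y'` skew of order `≡ d`; evidence `R90/R90-C10-p05/g3/WILD-COVER-GAP.v1.md` 9381e9d3).
This file is the assembly: ★'s proof :138–:201 with `cover_arith` ↦ ★ `cover_arith_wild`∕`_swap`∕`_zero` and the two ★ wild families.  For `n` even or `n = 2δ + 1` the cover is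
FALSE as an X∪Z statement (★ `not_cover_arith_wild_example`) — not claimed; that sub-cell carries one open lemma (R-SW-4 (c4), R90-C10-p07 (g3)'s census).
* §1 **`exists_depth_witness_twoDepth_ofDefect`** — binders = ★ `exists_depth_witness_twoDepth`'s with `(hkm hrr hss hr1 hr2 hs1 hs2 hal)` ↦ the (R-b) datum letters
  `(hδ1 : 1 ≤ δ) (hm : 2δ + 2 ≤ m) (hor : orientation)`, `k := 2δ` (so `hc₂ : |c₂| ≤ |ϖ|^{2δ}`), `(hvt)` ↦ `(htmin) (htδ : |t| = exp δ)`, plus the cell letter `hpar`; conclusion VERBATIM.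
CONSUMER: the wild twin of ★ p862990 `K2E3BranchAIrreducibleTwoDepthCells.exists_shellWitness_of_mem_map_of_not_mem` ∕ ★ (B-2b′) §2 (CM dress), then wild (8) §1 for (Rb-odd).
HONEST LABEL: HC_CM is proved only modulo the 7 printed citations (2 remaining named inputs: hLiu418 = stmt-HodgeConjecture-24832, h413 = stmt-HodgeConjecture-24833)
until rung 0 closes; count-neutral — pays no socket, closes nothing; (S-W) stays the XL residual of :182 ((S-W-Rb) = (Rb-odd) L without open lemma ⊔ (Rb-even∕min) L + 1 open lemma).

## References
* [Roche1998] A. Roche, *Types and Hecke algebras for principal series representations of split reductive p-adic groups*, Ann. Sci. ÉNS (4) 31 (1998), §3–§4.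
* [BruhatTits1972] F. Bruhat, J. Tits, *Groupes réductifs sur un corps local I*, Publ. Math. IHÉS 41 (1972), (6.4.9).
* [Tits1979] J. Tits, *Reductive groups over local fields*, Proc. Sympos. Pure Math. 33.1 (1979), §1.15.
* [Casselman1995] W. Casselman, *Introduction to the theory of admissible representations of `p`-adic reductive groups* (1995), §6.3.
* [Serre1979] J.-P. Serre, *Local Fields*, GTM 67 (1979), Ch. III §3 Prop. 7.
-/

set_option autoImplicit false
-- the mandated namespace repeats the single-problem summit's segment (`HodgeConjecture.HodgeConjecture`)
set_option linter.dupNamespace false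

noncomputable section

open Matrix Literature.NumberTheory.Automorphic Literature.NumberTheory.Automorphic.UnitaryGroup
open scoped Matrix MatrixGroups WithZero Pointwise

namespace Summit.HodgeConjecture.HodgeConjecture.R90.S1.WildDepthWitnessCover

open Summit.HodgeConjecture.HodgeConjecture.Cruxes.H413
open Summit.HodgeConjecture.HodgeConjecture.Cruxes.H413.K2E3TwoDepthDepthWitness
open Summit.HodgeConjecture.HodgeConjecture.Cruxes.H413.K2E3TwoDepthDepthWitnessCover
open Summit.HodgeConjecture.HodgeConjecture.R90.S1.WildFamilyXWitness
open Summit.HodgeConjecture.HodgeConjecture.R90.S1.WildFamilyZWitness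
open Summit.HodgeConjecture.HodgeConjecture.R90.S1.WildDepthWitnessCoverArith

section Valuation

variable {K : Type*} [Field K] [Valued K ℤᵐ⁰] [ValuativeRel K] [(Valued.v : Valuation K ℤᵐ⁰).Compatible]
  (σ : K →+* K) {ϖ : K} {J : Matrix (Fin 3) (Fin 3) K} (hJ : J = (StdForm.antidiagonal 3).over K)
  (hσ : ∀ a, σ (σ a) = a) (hvσ : ∀ a, Valued.v (σ a) = Valued.v a) (hvϖ : Valued.v ϖ = WithZero.exp (-1 : ℤ))
  (r s r' s' : ℕ) (Jg : Subgroup ↥(unitaryGroupOfForm σ J))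
  (hJg : ∀ k, k ∈ Jg ↔ ∀ i j, Valued.v (((k : GL (Fin 3) K) : Matrix (Fin 3) (Fin 3) K) i j) ≤
    Valued.v ϖ ^ (![![0, r, s], ![r', 0, r], ![s', r', 0]] : Fin 3 → Fin 3 → ℕ) i j)

/-! ## §1 The wild cover: (Rb-odd) datum, minimal `t` of defect `δ`, no-cancellation cells -/

include hJ hσ hvσ hvϖ hJg in
/-- **WILD DEPTH WITNESS ON EVERY INTERMEDIATE LOWER CELL OF `J_{e_W}` (families X ∪ Z with defect, ★ (c1)(c2)), sub-cell (Rb-odd).**  Exponents: the (R-b) datum in EITHER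
orientation — `(r, s; r', s') = (m∕2, δ; m∕2 + 1, δ + 1)` (`hor`, left) or `(m∕2 + 1, δ + 1; m∕2, δ)` (right) — with `m` EVEN implicit in `r + r = m` ∕ `r' + r' = m`, `2δ + 2 ≤ m`
(cond_E `n = m + 1` odd, `n ≥ 2δ + 3`), `1 ≤ δ`.  `ū ∈ U(σ, Φ₃)` with matrix `ū(x, z)` (`z + σz + xσx = 0`), `|z| ≤ 1`, off `J_e` (`¬(|x| ≤ |ϖ|^{r′} ∧ |z| ≤ |ϖ|^{s′})`) and off the sharp
big cell (`¬(|x∕z| ≤ |ϖ|ʳ ∧ |ϖ|^{−s} ≤ |z|)`); the WILD NO-CANCELLATION letter `hpar : |z| = |t|·|x|² ∨ ∃ j, |z| = exp(2j + δ + 1)` (`z = −t·N(x) + y'`, skew `y'` of order `≡ d`);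
`c₁ ∈ 𝔭ᵐ` arbitrary (cond_E witness), `c₂ ∈ 𝔭^{2δ}` `σ`-fixed (the cond_F witness at the threshold, ★ (W-2)); a MINIMAL trace-one `t` (`ht`, `htmin`) of EXACT defect `htδ : |t| = exp δ`
(★ bridge p865207 at a wild place).  Then some `u ∈ N` has `ū⁻¹ u ū ∈ J_e` and `(ū⁻¹ u ū)₀₀ = (1 + c)(1 + ε)`, `|ε| ≤ |ϖ|^{m+1}`, `c ∈ {c₁, c₂}` — the CONCLUSION of ★
`exists_depth_witness_twoDepth` VERBATIM.  Proof = ★'s case analysis with ★ `cover_arith_wild` ∕ `_swap` ∕ `_zero` and ★ (c1) `exists_familyX_witness_twoDepth_ofDefect` (with `c₁`),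
★ (c2) `exists_familyZ_witness_twoDepth_ofDefect` (with `c₂`). [cite: Roche1998, §3–§4] [cite: BruhatTits1972, (6.4.9)] [cite: Tits1979, §1.15] [cite: Casselman1995, §6.3]
[cite: Serre1979, Ch. III §3 Prop. 7] -/
theorem exists_depth_witness_twoDepth_ofDefect {m δ : ℕ} (hδ1 : 1 ≤ δ) (hm : 2 * δ + 2 ≤ m)
    (hor : (r + r = m ∧ r' = r + 1 ∧ s = δ ∧ s' = δ + 1) ∨ (r' + r' = m ∧ r = r' + 1 ∧ s = δ + 1 ∧ s' = δ))
    {nb : ↥(unitaryGroupOfForm σ J)} {x z c₁ c₂ t : K}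
    (hnb : ((nb : GL (Fin 3) K) : Matrix (Fin 3) (Fin 3) K) = !![1, 0, 0; -σ x, 1, 0; z, x, 1]) (hrel : z + σ z + x * σ x = 0)
    (hz1 : Valued.v z ≤ 1)
    (hpar : Valued.v z = Valued.v t * (Valued.v x * Valued.v x) ∨ ∃ j : ℤ, Valued.v z = WithZero.exp (2 * j + ((δ : ℤ) + 1)))
    (hoff : ¬ (Valued.v x ≤ Valued.v ϖ ^ r' ∧ Valued.v z ≤ Valued.v ϖ ^ s'))
    (hshal : ¬ (Valued.v (x / z) ≤ Valued.v ϖ ^ r ∧ (Valued.v ϖ ^ s)⁻¹ ≤ Valued.v z))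
    (hc₁ : Valued.v c₁ ≤ Valued.v ϖ ^ m) (hσc₂ : σ c₂ = c₂) (hc₂ : Valued.v c₂ ≤ Valued.v ϖ ^ (2 * δ))
    (ht : t + σ t = 1) (htmin : ∀ a : K, a + σ a = 1 → Valued.v t ≤ Valued.v a) (htδ : Valued.v t = WithZero.exp (δ : ℤ)) :
    ∃ u : ↥(unitaryGroupOfForm σ J), u ∈ unipotentU σ J ∧ nb⁻¹ * u * nb ∈ Jg ∧
      ∃ c ε : K, (c = c₁ ∨ c = c₂) ∧ Valued.v ε ≤ Valued.v ϖ ^ (m + 1) ∧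
        (((nb⁻¹ * u * nb : ↥(unitaryGroupOfForm σ J)) : GL (Fin 3) K) : Matrix (Fin 3) (Fin 3) K) 0 0 = (1 + c) * (1 + ε) := by
  have eϖ : ∀ n : ℕ, Valued.v ϖ ^ n = WithZero.exp (-(n : ℤ)) := v_pow_eq_exp hvϖ
  -- the defect letter of ★ (c1)(c2): `|t|·|ϖ|^δ ≤ 1` (here an equality)
  have hδ : Valued.v t * Valued.v ϖ ^ δ ≤ 1 := by
    rw [htδ, eϖ, ← WithZero.exp_add, ← WithZero.exp_zero, WithZero.exp_le_exp]; omega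
  have hm1 : 1 ≤ m := by omega
  have hk1 : 1 ≤ 2 * δ := by omega
  -- `|x|² ≤ |z| ≤ 1`
  have hxx : Valued.v x * Valued.v x ≤ Valued.v z := v_mul_v_le_of_rel σ hvσ hrel
  have hx1 : Valued.v x ≤ 1 := by
    by_contra h
    rw [not_le] at h
    exact absurd (h.trans_le ((le_mul_of_one_le_right' h.le).trans (hxx.trans hz1))) (lt_irrefl 1)
  -- `z ≠ 0` (else `x = 0` and `ū ∈ J_e`)
  have hz : z ≠ 0 := by
    rintro rfl
    have hx : x = 0 := by
      have h : Valued.v x * Valued.v x ≤ 0 := by rwa [map_zero] at hxx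
      exact (Valuation.zero_iff _).1 (mul_self_eq_zero.1 (le_zero_iff.1 h))
    subst hx
    exact hoff ⟨by rw [map_zero]; exact zero_le, by rw [map_zero]; exact zero_le⟩
  have hvz0 : Valued.v z ≠ 0 := (Valuation.ne_zero_iff _).2 hz
  obtain ⟨lz, ez⟩ : ∃ lz : ℤ, Valued.v z = WithZero.exp lz := ⟨_, (WithZero.exp_log hvz0).symm⟩
  have hz0' : lz ≤ 0 := by
    have h := hz1
    rw [ez, ← WithZero.exp_zero, WithZero.exp_le_exp] at h
    exact h
  -- the orientation as the `{s, s'} = {δ, δ+1}` letter of ★ `cover_arith_wild_zero`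
  have hss : (s = δ ∧ s' = δ + 1) ∨ (s = δ + 1 ∧ s' = δ) := by
    rcases hor with ⟨-, -, h1, h2⟩ | ⟨-, -, h1, h2⟩
    · exact Or.inl ⟨h1, h2⟩
    · exact Or.inr ⟨h1, h2⟩
  rcases eq_or_ne x 0 with hx0 | hx0
  · -- the column `x = 0`: family Z (★ (c2)) with `c₂`
    subst hx0
    have hoffz : ¬ lz ≤ -(s' : ℤ) := fun h => hoff ⟨by rw [map_zero]; exact zero_le, by rw [ez, eϖ, WithZero.exp_le_exp]; omega⟩
    have hshalz : ¬ (s : ℤ) ≤ lz := fun h =>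
      hshal ⟨by rw [zero_div, map_zero]; exact zero_le, by rw [eϖ, ← WithZero.exp_neg, ez, WithZero.exp_le_exp]; omega⟩
    obtain ⟨hk1', h1, h2⟩ := cover_arith_wild_zero (k := 2 * δ) hδ1 rfl hss hoffz hshalz
    obtain ⟨u, huN, hj, ε, hε, h00⟩ := exists_familyZ_witness_twoDepth_ofDefect σ hJ hσ hvσ hvϖ r s r' s' Jg hJg (m := m) (δ := δ) hk1' hnb hrel hx1 hz1
      (by rw [eϖ, eϖ, ez, ← WithZero.exp_add, WithZero.exp_le_exp]; omega)
      (by rw [map_zero, mul_zero]; exact zero_le)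
      (by rw [map_zero, mul_zero]; exact zero_le)
      (by rw [eϖ, eϖ, ez, ← WithZero.exp_add, WithZero.exp_le_exp]; omega)
      (by rw [map_zero, mul_zero, mul_zero]; exact zero_le)
      hσc₂ hc₂ ht htmin hδ
    exact ⟨u, huN, hj, c₂, ε, Or.inr rfl, hε, h00⟩
  · have hvx0 : Valued.v x ≠ 0 := (Valuation.ne_zero_iff _).2 hx0
    obtain ⟨lx, ex⟩ : ∃ lx : ℤ, Valued.v x = WithZero.exp lx := ⟨_, (WithZero.exp_log hvx0).symm⟩
    have hxx' : lx + lx ≤ lz := by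
      have h := hxx
      rw [ex, ez, ← WithZero.exp_add, WithZero.exp_le_exp] at h
      exact h
    have hoff' : ¬ (lx ≤ -(r' : ℤ) ∧ lz ≤ -(s' : ℤ)) := fun h =>
      hoff ⟨by rw [ex, eϖ, WithZero.exp_le_exp]; omega, by rw [ez, eϖ, WithZero.exp_le_exp]; omega⟩
    have hshal' : ¬ (lx + -lz ≤ -(r : ℤ) ∧ (s : ℤ) ≤ lz) := fun h =>
      hshal ⟨by rw [map_div₀, ex, ez, eϖ, div_eq_mul_inv, ← WithZero.exp_neg, ← WithZero.exp_add, WithZero.exp_le_exp]; omega,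
        by rw [eϖ, ← WithZero.exp_neg, ez, WithZero.exp_le_exp]; omega⟩
    -- the no-cancellation letter in integer form
    have hpar' : lz = lx + lx + (δ : ℤ) ∨ lz % 2 = (((δ : ℤ) + 1) % 2) := by
      rcases hpar with h | ⟨j, hj⟩
      · left
        rw [ez, htδ, ex, ← WithZero.exp_add, ← WithZero.exp_add] at h
        have h' := WithZero.exp_injective h
        omega
      · right
        rw [ez] at hj
        have h' := WithZero.exp_injective hj
        omega
    -- the two orientations: ★ `cover_arith_wild` ∕ ★ `cover_arith_wild_swap`
    have hcov : (-(m : ℤ) ≤ -(r : ℤ) + lx ∧ -(m : ℤ) + lz ≤ -(r' : ℤ) + lx ∧ -(m : ℤ) + lz + (δ : ℤ) ≤ -(1 : ℤ) + (lx + lx) ∧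
          r' ≤ m ∧ s' ≤ m ∧ s + δ ≤ 2 * r ∧ s' + δ ≤ 2 * r' ∧ δ ≤ m) ∨
        (1 ≤ 2 * δ ∧ -((2 * δ : ℕ) : ℤ) ≤ -(s : ℤ) + lz ∧ -((2 * δ : ℕ) : ℤ) + lx ≤ -(r : ℤ) + lz ∧ -((2 * δ : ℕ) : ℤ) + lx ≤ -(r' : ℤ) ∧
          -((2 * δ : ℕ) : ℤ) + lz ≤ -(s' : ℤ) ∧ -((2 * δ : ℕ) : ℤ) + (δ : ℤ) + (lx + lx) ≤ -((m : ℤ) + 1) + lz) := by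
      rcases hor with ⟨hrr, hr', hs, hs'⟩ | ⟨hrr, hr, hs, hs'⟩
      · exact cover_arith_wild (k := 2 * δ) hδ1 hm hrr hr' hs hs' rfl hz0' hpar' hoff' hshal'
      · exact cover_arith_wild_swap (k := 2 * δ) hδ1 hm hrr hr hs hs' rfl hz0' hpar' hoff' hshal'
    rcases hcov with ⟨h1, h2, h3, h4, h5, h6, h7, h8⟩ | ⟨hk1', h1, h2, h3, h4, h5⟩
    · -- family X (★ (c1)) with `c₁`
      obtain ⟨u, huN, hj, ε, hε, h00⟩ := exists_familyX_witness_twoDepth_ofDefect σ hJ hσ hvσ hvϖ r s r' s' Jg hJg hm1 hnb hrel hx1 hz1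
        (by rw [eϖ, eϖ, ex, ← WithZero.exp_add, WithZero.exp_le_exp]; omega)
        (by rw [eϖ, eϖ, ex, ez, ← WithZero.exp_add, ← WithZero.exp_add, WithZero.exp_le_exp]; omega)
        (δ := δ)
        (by rw [eϖ, eϖ, ex, ez, ← WithZero.exp_add, ← WithZero.exp_add, ← WithZero.exp_add, WithZero.exp_le_exp]; push_cast; omega)
        h4 h5 h6 h7 hc₁ ht hδ h8
      exact ⟨u, huN, hj, c₁, ε, Or.inl rfl, hε, h00⟩
    · -- family Z (★ (c2)) with `c₂`
      obtain ⟨u, huN, hj, ε, hε, h00⟩ := exists_familyZ_witness_twoDepth_ofDefect σ hJ hσ hvσ hvϖ r s r' s' Jg hJg (m := m) (δ := δ) hk1' hnb hrel hx1 hz1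
        (by rw [eϖ, eϖ, ez, ← WithZero.exp_add, WithZero.exp_le_exp]; push_cast at h1 ⊢; omega)
        (by rw [eϖ, eϖ, ex, ez, ← WithZero.exp_add, ← WithZero.exp_add, WithZero.exp_le_exp]; push_cast at h2 ⊢; omega)
        (by rw [eϖ, eϖ, ex, ← WithZero.exp_add, WithZero.exp_le_exp]; push_cast at h3 ⊢; omega)
        (by rw [eϖ, eϖ, ez, ← WithZero.exp_add, WithZero.exp_le_exp]; push_cast at h4 ⊢; omega)
        (by rw [eϖ, eϖ, ex, ez, ← WithZero.exp_add, ← WithZero.exp_add, ← WithZero.exp_add, WithZero.exp_le_exp]; push_cast at h5 ⊢; omega)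
        hσc₂ hc₂ ht htmin hδ
      exact ⟨u, huN, hj, c₂, ε, Or.inr rfl, hε, h00⟩

end Valuation

end Summit.HodgeConjecture.HodgeConjecture.R90.S1.WildDepthWitnessCover

end
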